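import Literature.Probability.Percolation.TwoSetExchange
import Literature.Probability.LatticeModels.SahiThirdOrderCorrelation
import HarnessLib

/-!
# Conditional Sahi `E₃ ≥ 0` given a two-cluster separation, when one of the three cells is a pure avoidance cell

Topic `Literature/Probability/Percolation`.  Bond percolation with arbitrary edge probabilities `w` on a finite vertex
type (`μ = prodBernoulli w`), two vertices `s, t`, `D = {s ↮ t}`.  A **BHK-monotone cell** for the pair `(s,t)` is an
event of the form `F(Z, W) = {Z ↔ s} ∩ {W ↮ t} = {ω | ∀ z ∈ Z, s ↔ z} ∩ {ω | ∀ x ∈ W, t ↮ x}` (increasing in the open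
cluster `C_s`, decreasing in `C_t` — the events whose indicators van den Berg–Häggström–Kahn's Theorem 1.5 declares
positively associated given `D` [VandenbergHaggstromKahn2005, Thm. 1.5 p. 7]).  For three events `F₁, F₂, F₃` write
`x_I = μ(D ∩ ⋂_{i∈I} F_i)`, `d = μ(D)`; Sahi's third-order functional of `1_{F₁}, 1_{F₂}, 1_{F₃}` under the CONDITIONAL
measure `μ(· | D)`, multiplied by `d³`, is
`R := 2·x₁₂₃·d² + x₁x₂x₃ − d·(x₁x₂₃ + x₂x₁₃ + x₃x₁₂)`  (`= d³ · E₃^{μ(·|D)}(1_{F₁},1_{F₂},1_{F₃})`, [LiebSahi2021, eq. (2.1)],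
[Sahi2008, p. 213]).

**Theorem (`condSahiE3_nonneg_of_avoidanceCell`).**  If `F₁ = F(Z₁,W₁)`, `F₂ = F(Z₂,W₂)` are BHK-monotone cells and
`F₃ = F(∅, W₃) = {W₃ ↮ t}` is a PURE AVOIDANCE cell, then `R ≥ 0`.
**Theorem (`condSahiE3_nonneg_of_repeatedCell`).**  If two of the three cells coincide (`F₁ = F₂ = F(Z₁,W₁)`, `F₃ = F(Z₂,W₂)`
arbitrary BHK-monotone cells), then `R = (d − x₁)(2d·x₁₃ − x₁x₃) ≥ 0` (BHK Thm 1.5 given `D` alone).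
**Theorem (`condSahiE3_nonneg_of_nestedCells`).**  If `F₁ ⊆ F₂` (`Z₂ ⊆ Z₁`, `W₂ ⊆ W₁`) and `F₃` is arbitrary, then
`R = (d·x₁₃ − x₁x₃)(2d − x₂) + d·x₁(x₃ − x₂₃) ≥ 0` (BHK Thm 1.5 given `D` + monotonicity).

This is the conditional ("(3, BHK)") analogue of the proved principal-up-set case of Sahi's conjecture
(`Literature.Probability.LatticeModels.latticeE3_nonneg_of_principal`: `E₃ ≥ 0` when one of three up-sets is principal),
and is proved by the same mechanism — Blinovsky's cubic identity [Blinovsky2013, Appendix]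
`x₃·R = d²(x₃x₁₂₃ − x₁₃x₂₃) + d·x₃(d·x₁₂₃ − x₃x₁₂) + (d·x₁₃ − x₁x₃)(d·x₂₃ − x₂x₃)`
— with the two-function input supplied by BHK instead of Harris/FKG: the last three brackets are BHK Thm 1.5 given
`D` (cells and intersections of cells are again cells), and the first bracket is positive correlation of `F₁, F₂` given
`D ∩ F₃ = {({s} ∪ W₃) ↮ t}`, which is BHK's Theorem 2.1 (sets of sources, `q = 1`) read for the single clusters
`C_s ⊆ C_{{s}∪W₃}`, `C_t` — in the tree `guardedTwoClusterExchange` (`TwoSetExchange.lean`).  Not stated in print; all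
ingredients are [VandenbergHaggstromKahn2005, Thm. 1.5 (p. 7), Thm. 2.1 (p. 9) at q = 1, Remark 1 (p. 5)].
STATUS of the general conditional statement (three DISTINCT BHK-monotone cells, none a pure avoidance cell): open —
it is the `(3, BHK)` entry of this programme's MASTER-FAMILY table for crux stmt-CriticalPhenomena-4575 (census filed,
ttrl requests l.354); the one-conditioning mechanism does NOT reach it (conditioning on a cell containing a connection
`{z ↔ s}` is conditioning on an increasing event of `C_s`, under which BHK association is not available).
No definitions, no named facts, no sorries.
-/

noncomputable section

open MeasureTheory Set
open Literature.Probability.LatticeModels (prodBernoulli)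

namespace Literature.Probability.Percolation

variable {V : Type*}

namespace CondSahiE3

/-- A BHK-monotone cell `{Z ↔ s} ∩ {W ↮ t}` is closed under enlarging `C_s` and shrinking `C_t`
(the hypothesis shape of `guardedTwoClusterExchange`). [cite: VandenbergHaggstromKahn2005, §1 p. 3 and Thm. 1.5 (p. 7)] -/
theorem cell_closed (s t : V) (Z W : Set V) ⦃ω ω' : BondConfig V⦄
    (hs : openEdgeCluster ω s ⊆ openEdgeCluster ω' s) (ht : openEdgeCluster ω' t ⊆ openEdgeCluster ω t)
    (h : ω ∈ {ω : BondConfig V | (∀ z ∈ Z, (openGraph ω).Reachable s z) ∧ ∀ x ∈ W, ¬ (openGraph ω).Reachable t x}) :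
    ω' ∈ {ω : BondConfig V | (∀ z ∈ Z, (openGraph ω).Reachable s z) ∧ ∀ x ∈ W, ¬ (openGraph ω).Reachable t x} := by
  obtain ⟨hZ, hW⟩ := h
  refine ⟨fun z hz => ?_, fun x hx hr => hW x hx ?_⟩
  · rw [reachable_iff_exists_mem_openEdgeCluster]
    rcases (reachable_iff_exists_mem_openEdgeCluster ω s z).1 (hZ z hz) with h1 | ⟨e, he, hze⟩
    · exact Or.inl h1
    · exact Or.inr ⟨e, hs he, hze⟩
  · rw [reachable_iff_exists_mem_openEdgeCluster]
    rcases (reachable_iff_exists_mem_openEdgeCluster ω' t x).1 hr with h1 | ⟨e, he, hxe⟩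
    · exact Or.inl h1
    · exact Or.inr ⟨e, ht he, hxe⟩

/-- **BHK positive correlation of two cells given `{S ↮ t}`** (event form, `s ∈ S`): for cells `A₁, A₂` of the pair
`(s,t)` and `G = {ω | ∀ s' ∈ S, s' ↮ t}`, `μ(G ∩ A₁) μ(G ∩ A₂) ≤ μ(G ∩ (A₁ ∩ A₂)) μ(G)` — `guardedTwoClusterExchange`
with trivial minus-type events. [cite: VandenbergHaggstromKahn2005, Thm. 2.1 (p. 9) at q = 1 — corollary via `guardedTwoClusterExchange`] -/
theorem guard_posCorr [Fintype V] (w : Sym2 V → unitInterval) (S : Set V) {s t : V} (hs : s ∈ S)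
    {A₁ A₂ : Set (BondConfig V)}
    (hA₁ : ∀ ⦃ω ω' : BondConfig V⦄, openEdgeCluster ω s ⊆ openEdgeCluster ω' s →
      openEdgeCluster ω' t ⊆ openEdgeCluster ω t → ω ∈ A₁ → ω' ∈ A₁)
    (hA₂ : ∀ ⦃ω ω' : BondConfig V⦄, openEdgeCluster ω s ⊆ openEdgeCluster ω' s →
      openEdgeCluster ω' t ⊆ openEdgeCluster ω t → ω ∈ A₂ → ω' ∈ A₂) :
    (prodBernoulli w).real ({ω : BondConfig V | ∀ s' ∈ S, ∀ t' ∈ ({t} : Set V), ¬ (openGraph ω).Reachable s' t'} ∩ A₁) *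
      (prodBernoulli w).real ({ω : BondConfig V | ∀ s' ∈ S, ∀ t' ∈ ({t} : Set V), ¬ (openGraph ω).Reachable s' t'} ∩ A₂) ≤
    (prodBernoulli w).real ({ω : BondConfig V | ∀ s' ∈ S, ∀ t' ∈ ({t} : Set V), ¬ (openGraph ω).Reachable s' t'} ∩
        (A₁ ∩ A₂)) *
      (prodBernoulli w).real {ω : BondConfig V | ∀ s' ∈ S, ∀ t' ∈ ({t} : Set V), ¬ (openGraph ω).Reachable s' t'} := by
  have key := guardedTwoClusterExchange w S ({t} : Set V) hs (Set.mem_singleton t)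
    (A₁ := A₁) (A₂ := A₂) (B₁ := Set.univ) (B₂ := Set.univ) hA₁ hA₂
    (fun _ _ _ _ _ => Set.mem_univ _) (fun _ _ _ _ _ => Set.mem_univ _)
  simpa only [Set.inter_univ, Set.univ_inter] using key

end CondSahiE3

open CondSahiE3 in
/-- **Conditional Sahi `E₃ ≥ 0` given `{s ↮ t}` when one cell is a pure avoidance cell.**  For bond percolation with
arbitrary edge probabilities `w` on a finite vertex type, vertices `s, t`, vertex sets `Z₁, W₁, Z₂, W₂, W₃`, with
`D = {s ↮ t}`, `F_i = {Z_i ↔ s} ∩ {W_i ↮ t}` (`i = 1,2`), `F₃ = {W₃ ↮ t}` and `x_I = μ(D ∩ ⋂_{i∈I} F_i)`, `d = μ(D)`: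
`0 ≤ 2·x₁₂₃·d² + x₁x₂x₃ − d·(x₁x₂₃ + x₂x₁₃ + x₃x₁₂)`, i.e. `d³ · E₃(1_{F₁},1_{F₂},1_{F₃}) ≥ 0` under `μ(· | D)`.
Proof: Blinovsky's identity for `x₃·R` (ring) with the four two-function inequalities from `guard_posCorr`
(`S = {s} ∪ W₃` for the conditional covariance of `F₁, F₂` given `D ∩ F₃`; `S = {s}` for the three given `D`).
Not stated in print. [cite: VandenbergHaggstromKahn2005, Thm. 1.5 (p. 7) and Thm. 2.1 (p. 9) at q = 1; Blinovsky2013, Appendix (arXiv text p. 3); LiebSahi2021, eq. (2.1)] -/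
theorem condSahiE3_nonneg_of_avoidanceCell [Fintype V] (w : Sym2 V → unitInterval) (s t : V)
    (Z₁ W₁ Z₂ W₂ W₃ : Set V) :
    0 ≤ 2 * (prodBernoulli w).real ({ω : BondConfig V | ¬ (openGraph ω).Reachable s t} ∩
          ({ω : BondConfig V | (∀ z ∈ Z₁, (openGraph ω).Reachable s z) ∧ ∀ x ∈ W₁, ¬ (openGraph ω).Reachable t x} ∩
          {ω : BondConfig V | (∀ z ∈ Z₂, (openGraph ω).Reachable s z) ∧ ∀ x ∈ W₂, ¬ (openGraph ω).Reachable t x} ∩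
          {ω : BondConfig V | ∀ x ∈ W₃, ¬ (openGraph ω).Reachable t x})) *
        (prodBernoulli w).real {ω : BondConfig V | ¬ (openGraph ω).Reachable s t} ^ 2 +
      (prodBernoulli w).real ({ω : BondConfig V | ¬ (openGraph ω).Reachable s t} ∩
          {ω : BondConfig V | (∀ z ∈ Z₁, (openGraph ω).Reachable s z) ∧ ∀ x ∈ W₁, ¬ (openGraph ω).Reachable t x}) *
        (prodBernoulli w).real ({ω : BondConfig V | ¬ (openGraph ω).Reachable s t} ∩
          {ω : BondConfig V | (∀ z ∈ Z₂, (openGraph ω).Reachable s z) ∧ ∀ x ∈ W₂, ¬ (openGraph ω).Reachable t x}) *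
        (prodBernoulli w).real ({ω : BondConfig V | ¬ (openGraph ω).Reachable s t} ∩
          {ω : BondConfig V | ∀ x ∈ W₃, ¬ (openGraph ω).Reachable t x}) -
      (prodBernoulli w).real {ω : BondConfig V | ¬ (openGraph ω).Reachable s t} *
        ((prodBernoulli w).real ({ω : BondConfig V | ¬ (openGraph ω).Reachable s t} ∩
            {ω : BondConfig V | (∀ z ∈ Z₁, (openGraph ω).Reachable s z) ∧ ∀ x ∈ W₁, ¬ (openGraph ω).Reachable t x}) *
          (prodBernoulli w).real ({ω : BondConfig V | ¬ (openGraph ω).Reachable s t} ∩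
            ({ω : BondConfig V | (∀ z ∈ Z₂, (openGraph ω).Reachable s z) ∧ ∀ x ∈ W₂, ¬ (openGraph ω).Reachable t x} ∩
            {ω : BondConfig V | ∀ x ∈ W₃, ¬ (openGraph ω).Reachable t x})) +
        (prodBernoulli w).real ({ω : BondConfig V | ¬ (openGraph ω).Reachable s t} ∩
            {ω : BondConfig V | (∀ z ∈ Z₂, (openGraph ω).Reachable s z) ∧ ∀ x ∈ W₂, ¬ (openGraph ω).Reachable t x}) *
          (prodBernoulli w).real ({ω : BondConfig V | ¬ (openGraph ω).Reachable s t} ∩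
            ({ω : BondConfig V | (∀ z ∈ Z₁, (openGraph ω).Reachable s z) ∧ ∀ x ∈ W₁, ¬ (openGraph ω).Reachable t x} ∩
            {ω : BondConfig V | ∀ x ∈ W₃, ¬ (openGraph ω).Reachable t x})) +
        (prodBernoulli w).real ({ω : BondConfig V | ¬ (openGraph ω).Reachable s t} ∩
            {ω : BondConfig V | ∀ x ∈ W₃, ¬ (openGraph ω).Reachable t x}) *
          (prodBernoulli w).real ({ω : BondConfig V | ¬ (openGraph ω).Reachable s t} ∩
            ({ω : BondConfig V | (∀ z ∈ Z₁, (openGraph ω).Reachable s z) ∧ ∀ x ∈ W₁, ¬ (openGraph ω).Reachable t x} ∩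
            {ω : BondConfig V | (∀ z ∈ Z₂, (openGraph ω).Reachable s z) ∧ ∀ x ∈ W₂, ¬ (openGraph ω).Reachable t x}))) := by
  classical
  -- names
  set μ := prodBernoulli w with hμ
  set D : Set (BondConfig V) := {ω | ¬ (openGraph ω).Reachable s t} with hD
  set F₁ : Set (BondConfig V) :=
    {ω | (∀ z ∈ Z₁, (openGraph ω).Reachable s z) ∧ ∀ x ∈ W₁, ¬ (openGraph ω).Reachable t x} with hF₁
  set F₂ : Set (BondConfig V) :=
    {ω | (∀ z ∈ Z₂, (openGraph ω).Reachable s z) ∧ ∀ x ∈ W₂, ¬ (openGraph ω).Reachable t x} with hF₂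
  set F₃ : Set (BondConfig V) := {ω | ∀ x ∈ W₃, ¬ (openGraph ω).Reachable t x} with hF₃
  -- the cells are BHK-monotone; `F₃` as the cell `F(∅, W₃)`
  have hc₁ := cell_closed s t Z₁ W₁
  have hc₂ := cell_closed s t Z₂ W₂
  have hF₃cell : F₃ = {ω : BondConfig V | (∀ z ∈ (∅ : Set V), (openGraph ω).Reachable s z) ∧
      ∀ x ∈ W₃, ¬ (openGraph ω).Reachable t x} := by
    ext ω; simp [hF₃]
  have hc₃ : ∀ ⦃ω ω' : BondConfig V⦄, openEdgeCluster ω s ⊆ openEdgeCluster ω' s →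
      openEdgeCluster ω' t ⊆ openEdgeCluster ω t → ω ∈ F₃ → ω' ∈ F₃ := by
    rw [hF₃cell]; exact cell_closed s t ∅ W₃
  have hc₁₂ : ∀ ⦃ω ω' : BondConfig V⦄, openEdgeCluster ω s ⊆ openEdgeCluster ω' s →
      openEdgeCluster ω' t ⊆ openEdgeCluster ω t → ω ∈ F₁ ∩ F₂ → ω' ∈ F₁ ∩ F₂ :=
    fun ω ω' h1 h2 h => ⟨hc₁ h1 h2 h.1, hc₂ h1 h2 h.2⟩
  -- the two guard events: `{({s}) ↮ t} = D` and `{({s} ∪ W₃) ↮ t} = D ∩ F₃`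
  have hG₁ : {ω : BondConfig V | ∀ s' ∈ ({s} : Set V), ∀ t' ∈ ({t} : Set V), ¬ (openGraph ω).Reachable s' t'} = D := by
    ext ω; simp [hD]
  have hG₃ : {ω : BondConfig V | ∀ s' ∈ insert s W₃, ∀ t' ∈ ({t} : Set V), ¬ (openGraph ω).Reachable s' t'} =
      D ∩ F₃ := by
    ext ω
    simp only [mem_setOf_eq, mem_insert_iff, mem_singleton_iff, forall_eq_or_imp, forall_eq, mem_inter_iff, hD, hF₃]
    refine ⟨fun h => ⟨h.1, fun x hx hr => h.2 x hx hr.symm⟩, fun h => ⟨h.1, fun x hx hr => h.2 x hx hr.symm⟩⟩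
  -- (i) `x₁₃ x₂₃ ≤ x₁₂₃ x₃`: positive correlation of `F₁, F₂` given `D ∩ F₃`
  have h1 := guard_posCorr w (insert s W₃) (Set.mem_insert s W₃) (t := t) hc₁ hc₂
  rw [hG₃] at h1
  -- (ii) `x₃ x₁₂ ≤ d x₁₂₃`, (iii) `x₁ x₃ ≤ d x₁₃`, `x₂ x₃ ≤ d x₂₃`: BHK Thm 1.5 given `D`
  have h2 := guard_posCorr w ({s} : Set V) (Set.mem_singleton s) (t := t) hc₁₂ hc₃
  have h3 := guard_posCorr w ({s} : Set V) (Set.mem_singleton s) (t := t) hc₁ hc₃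
  have h4 := guard_posCorr w ({s} : Set V) (Set.mem_singleton s) (t := t) hc₂ hc₃
  rw [hG₁] at h2 h3 h4
  -- normalise the intersections
  have e13 : D ∩ F₃ ∩ F₁ = D ∩ (F₁ ∩ F₃) := by ext ω; simp only [mem_inter_iff]; tauto
  have e23 : D ∩ F₃ ∩ F₂ = D ∩ (F₂ ∩ F₃) := by ext ω; simp only [mem_inter_iff]; tauto
  have e123 : D ∩ F₃ ∩ (F₁ ∩ F₂) = D ∩ (F₁ ∩ F₂ ∩ F₃) := by ext ω; simp only [mem_inter_iff]; tauto
  rw [e13, e23, e123] at h1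
  -- abbreviate the reals
  set d := μ.real D with hd
  set x1 := μ.real (D ∩ F₁) with hx1
  set x2 := μ.real (D ∩ F₂) with hx2
  set x3 := μ.real (D ∩ F₃) with hx3
  set x12 := μ.real (D ∩ (F₁ ∩ F₂)) with hx12
  set x13 := μ.real (D ∩ (F₁ ∩ F₃)) with hx13
  set x23 := μ.real (D ∩ (F₂ ∩ F₃)) with hx23
  set x123 := μ.real (D ∩ (F₁ ∩ F₂ ∩ F₃)) with hx123
  -- h1 : x13 * x23 ≤ x123 * x3 ; h2 : x12 * x3 ≤ x123 * d ; h3 : x1 * x3 ≤ x13 * d ; h4 : x2 * x3 ≤ x23 * d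
  have hd0 : 0 ≤ d := measureReal_nonneg
  have hx30 : 0 ≤ x3 := measureReal_nonneg
  have key : x3 * (2 * x123 * d ^ 2 + x1 * x2 * x3 - d * (x1 * x23 + x2 * x13 + x3 * x12)) =
      d ^ 2 * (x123 * x3 - x13 * x23) + d * x3 * (x123 * d - x12 * x3) +
        (x13 * d - x1 * x3) * (x23 * d - x2 * x3) := by ring
  have hprod : 0 ≤ x3 * (2 * x123 * d ^ 2 + x1 * x2 * x3 - d * (x1 * x23 + x2 * x13 + x3 * x12)) := by
    rw [key]
    have t1 : 0 ≤ d ^ 2 * (x123 * x3 - x13 * x23) := mul_nonneg (pow_nonneg hd0 2) (sub_nonneg.2 h1)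
    have t2 : 0 ≤ d * x3 * (x123 * d - x12 * x3) := mul_nonneg (mul_nonneg hd0 hx30) (sub_nonneg.2 h2)
    have t3 : 0 ≤ (x13 * d - x1 * x3) * (x23 * d - x2 * x3) := mul_nonneg (sub_nonneg.2 h3) (sub_nonneg.2 h4)
    linarith
  -- the goal, in the abbreviations (the statement groups `F₁ ∩ F₂ ∩ F₃` and `F₂ ∩ F₃`, `F₁ ∩ F₃`, `F₁ ∩ F₂` as below)
  show 0 ≤ 2 * μ.real (D ∩ (F₁ ∩ F₂ ∩ F₃)) * d ^ 2 + x1 * x2 * x3 -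
      d * (x1 * μ.real (D ∩ (F₂ ∩ F₃)) + x2 * μ.real (D ∩ (F₁ ∩ F₃)) + x3 * μ.real (D ∩ (F₁ ∩ F₂)))
  rw [← hx123, ← hx23, ← hx13, ← hx12]
  by_cases hx3pos : 0 < x3
  · by_contra hR
    push Not at hR
    have := mul_neg_of_pos_of_neg hx3pos hR
    linarith
  · -- `x3 = 0`: then `x13 = x23 = x123 = 0` and `R = 0`
    have hx3z : x3 = 0 := le_antisymm (not_lt.1 hx3pos) hx30
    have hx13z : x13 = 0 := le_antisymm (hx3z ▸ measureReal_mono (by intro ω hω; exact ⟨hω.1, hω.2.2⟩))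
      measureReal_nonneg
    have hx23z : x23 = 0 := le_antisymm (hx3z ▸ measureReal_mono (by intro ω hω; exact ⟨hω.1, hω.2.2⟩))
      measureReal_nonneg
    have hx123z : x123 = 0 := le_antisymm (hx3z ▸ measureReal_mono (by intro ω hω; exact ⟨hω.1, hω.2.2⟩))
      measureReal_nonneg
    rw [hx3z, hx13z, hx23z, hx123z]
    ring_nf
    exact le_rfl

open CondSahiE3 in
/-- **Conditional Sahi `E₃ ≥ 0` given `{s ↮ t}` for a REPEATED cell** (the multiset rows `(F, F, G)`).  For BHK-monotone
cells `F = {Z₁ ↔ s} ∩ {W₁ ↮ t}`, `G = {Z₂ ↔ s} ∩ {W₂ ↮ t}`, `D = {s ↮ t}`, `d = μ(D)`, `x = μ(D ∩ F)`, `y = μ(D ∩ G)`,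
`z = μ(D ∩ F ∩ G)`, the row `R(F,F,G) = 2·z·d² + x·x·y − d·(x·z + x·z + y·x)` (written below exactly as the general row with
`F₁ = F₂ = F`, intersections `F ∩ F` unexpanded) factors as `(d − x)·(2dz − xy)` and is `≥ 0` because `x ≤ d` and
`xy ≤ dz` (BHK Thm 1.5 given `D`, via `guard_posCorr`).  So every conditional-`E₃` row with a repeated cell is a theorem;
only rows with three distinct cells each containing a connection remain open.  Not stated in print.
[cite: VandenbergHaggstromKahn2005, Thm. 1.5 (p. 7); LiebSahi2021, eq. (2.1)] -/
theorem condSahiE3_nonneg_of_repeatedCell [Fintype V] (w : Sym2 V → unitInterval) (s t : V)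
    (Z₁ W₁ Z₂ W₂ : Set V) :
    0 ≤ 2 * (prodBernoulli w).real ({ω : BondConfig V | ¬ (openGraph ω).Reachable s t} ∩
          ({ω : BondConfig V | (∀ z ∈ Z₁, (openGraph ω).Reachable s z) ∧ ∀ x ∈ W₁, ¬ (openGraph ω).Reachable t x} ∩
          {ω : BondConfig V | (∀ z ∈ Z₁, (openGraph ω).Reachable s z) ∧ ∀ x ∈ W₁, ¬ (openGraph ω).Reachable t x} ∩
          {ω : BondConfig V | (∀ z ∈ Z₂, (openGraph ω).Reachable s z) ∧ ∀ x ∈ W₂, ¬ (openGraph ω).Reachable t x})) *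
        (prodBernoulli w).real {ω : BondConfig V | ¬ (openGraph ω).Reachable s t} ^ 2 +
      (prodBernoulli w).real ({ω : BondConfig V | ¬ (openGraph ω).Reachable s t} ∩
          {ω : BondConfig V | (∀ z ∈ Z₁, (openGraph ω).Reachable s z) ∧ ∀ x ∈ W₁, ¬ (openGraph ω).Reachable t x}) *
        (prodBernoulli w).real ({ω : BondConfig V | ¬ (openGraph ω).Reachable s t} ∩
          {ω : BondConfig V | (∀ z ∈ Z₁, (openGraph ω).Reachable s z) ∧ ∀ x ∈ W₁, ¬ (openGraph ω).Reachable t x}) *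
        (prodBernoulli w).real ({ω : BondConfig V | ¬ (openGraph ω).Reachable s t} ∩
          {ω : BondConfig V | (∀ z ∈ Z₂, (openGraph ω).Reachable s z) ∧ ∀ x ∈ W₂, ¬ (openGraph ω).Reachable t x}) -
      (prodBernoulli w).real {ω : BondConfig V | ¬ (openGraph ω).Reachable s t} *
        ((prodBernoulli w).real ({ω : BondConfig V | ¬ (openGraph ω).Reachable s t} ∩
            {ω : BondConfig V | (∀ z ∈ Z₁, (openGraph ω).Reachable s z) ∧ ∀ x ∈ W₁, ¬ (openGraph ω).Reachable t x}) *
          (prodBernoulli w).real ({ω : BondConfig V | ¬ (openGraph ω).Reachable s t} ∩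
            ({ω : BondConfig V | (∀ z ∈ Z₁, (openGraph ω).Reachable s z) ∧ ∀ x ∈ W₁, ¬ (openGraph ω).Reachable t x} ∩
            {ω : BondConfig V | (∀ z ∈ Z₂, (openGraph ω).Reachable s z) ∧ ∀ x ∈ W₂, ¬ (openGraph ω).Reachable t x})) +
        (prodBernoulli w).real ({ω : BondConfig V | ¬ (openGraph ω).Reachable s t} ∩
            {ω : BondConfig V | (∀ z ∈ Z₁, (openGraph ω).Reachable s z) ∧ ∀ x ∈ W₁, ¬ (openGraph ω).Reachable t x}) *
          (prodBernoulli w).real ({ω : BondConfig V | ¬ (openGraph ω).Reachable s t} ∩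
            ({ω : BondConfig V | (∀ z ∈ Z₁, (openGraph ω).Reachable s z) ∧ ∀ x ∈ W₁, ¬ (openGraph ω).Reachable t x} ∩
            {ω : BondConfig V | (∀ z ∈ Z₂, (openGraph ω).Reachable s z) ∧ ∀ x ∈ W₂, ¬ (openGraph ω).Reachable t x})) +
        (prodBernoulli w).real ({ω : BondConfig V | ¬ (openGraph ω).Reachable s t} ∩
            {ω : BondConfig V | (∀ z ∈ Z₂, (openGraph ω).Reachable s z) ∧ ∀ x ∈ W₂, ¬ (openGraph ω).Reachable t x}) *
          (prodBernoulli w).real ({ω : BondConfig V | ¬ (openGraph ω).Reachable s t} ∩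
            ({ω : BondConfig V | (∀ z ∈ Z₁, (openGraph ω).Reachable s z) ∧ ∀ x ∈ W₁, ¬ (openGraph ω).Reachable t x} ∩
            {ω : BondConfig V | (∀ z ∈ Z₁, (openGraph ω).Reachable s z) ∧ ∀ x ∈ W₁, ¬ (openGraph ω).Reachable t x}))) := by
  classical
  set μ := prodBernoulli w with hμ
  set D : Set (BondConfig V) := {ω | ¬ (openGraph ω).Reachable s t} with hD
  set F : Set (BondConfig V) :=
    {ω | (∀ z ∈ Z₁, (openGraph ω).Reachable s z) ∧ ∀ x ∈ W₁, ¬ (openGraph ω).Reachable t x} with hF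
  set G : Set (BondConfig V) :=
    {ω | (∀ z ∈ Z₂, (openGraph ω).Reachable s z) ∧ ∀ x ∈ W₂, ¬ (openGraph ω).Reachable t x} with hG
  have hc₁ := cell_closed s t Z₁ W₁
  have hc₂ := cell_closed s t Z₂ W₂
  have hG₁ : {ω : BondConfig V | ∀ s' ∈ ({s} : Set V), ∀ t' ∈ ({t} : Set V), ¬ (openGraph ω).Reachable s' t'} = D := by
    ext ω; simp [hD]
  -- BHK Thm 1.5 given `D`: `x * y ≤ z * d`
  have h1 := guard_posCorr w ({s} : Set V) (Set.mem_singleton s) (t := t) hc₁ hc₂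
  rw [hG₁] at h1
  -- collapse the repeated cell
  rw [Set.inter_self]
  set d := μ.real D with hd
  set x := μ.real (D ∩ F) with hx
  set y := μ.real (D ∩ G) with hy
  set z := μ.real (D ∩ (F ∩ G)) with hz
  -- h1 : x * y ≤ z * d
  have hxd : x ≤ d := measureReal_mono Set.inter_subset_left
  have hd0 : 0 ≤ d := measureReal_nonneg
  have hz0 : 0 ≤ z := measureReal_nonneg
  have key : 2 * z * d ^ 2 + x * x * y - d * (x * z + x * z + y * x) = (d - x) * (2 * (z * d) - x * y) := by ring
  rw [key]
  exact mul_nonneg (sub_nonneg.2 hxd) (by nlinarith [mul_nonneg hz0 hd0])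

open CondSahiE3 in
/-- **Conditional Sahi `E₃ ≥ 0` given `{s ↮ t}` for a NESTED pair of cells** (rows `(F₁, F₂, F₃)` with `F₁ ⊆ F₂` as
events, i.e. `Z₂ ⊆ Z₁` and `W₂ ⊆ W₁`; `F₃` an arbitrary BHK-monotone cell; contains the repeated-cell case).  With
`d = μ(D)`, `x_I = μ(D ∩ ⋂ F_i)`: since `F₁ ∩ F₂ = F₁`, the row is
`R = (d·x₁₃ − x₁x₃)(2d − x₂) + d·x₁(x₃ − x₂₃) ≥ 0` — BHK Thm 1.5 given `D` for `(F₁,F₃)` plus monotonicity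
(`x₂ ≤ d`, `x₂₃ ≤ x₃`).  This is the conditional form of the elementary unconditional fact
`E₃(A,B,C) ≥ μ(A)(μ(C) − μ(B∩C)) ≥ 0` for `A ⊆ B` and `A, C` positively correlated.  Not stated in print.
[cite: VandenbergHaggstromKahn2005, Thm. 1.5 (p. 7); LiebSahi2021, eq. (2.1)] -/
theorem condSahiE3_nonneg_of_nestedCells [Fintype V] (w : Sym2 V → unitInterval) (s t : V)
    (Z₁ W₁ Z₂ W₂ Z₃ W₃ : Set V) (hZ : Z₂ ⊆ Z₁) (hW : W₂ ⊆ W₁) :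
    0 ≤ 2 * (prodBernoulli w).real ({ω : BondConfig V | ¬ (openGraph ω).Reachable s t} ∩
          ({ω : BondConfig V | (∀ z ∈ Z₁, (openGraph ω).Reachable s z) ∧ ∀ x ∈ W₁, ¬ (openGraph ω).Reachable t x} ∩
          {ω : BondConfig V | (∀ z ∈ Z₂, (openGraph ω).Reachable s z) ∧ ∀ x ∈ W₂, ¬ (openGraph ω).Reachable t x} ∩
          {ω : BondConfig V | (∀ z ∈ Z₃, (openGraph ω).Reachable s z) ∧ ∀ x ∈ W₃, ¬ (openGraph ω).Reachable t x})) *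
        (prodBernoulli w).real {ω : BondConfig V | ¬ (openGraph ω).Reachable s t} ^ 2 +
      (prodBernoulli w).real ({ω : BondConfig V | ¬ (openGraph ω).Reachable s t} ∩
          {ω : BondConfig V | (∀ z ∈ Z₁, (openGraph ω).Reachable s z) ∧ ∀ x ∈ W₁, ¬ (openGraph ω).Reachable t x}) *
        (prodBernoulli w).real ({ω : BondConfig V | ¬ (openGraph ω).Reachable s t} ∩
          {ω : BondConfig V | (∀ z ∈ Z₂, (openGraph ω).Reachable s z) ∧ ∀ x ∈ W₂, ¬ (openGraph ω).Reachable t x}) *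
        (prodBernoulli w).real ({ω : BondConfig V | ¬ (openGraph ω).Reachable s t} ∩
          {ω : BondConfig V | (∀ z ∈ Z₃, (openGraph ω).Reachable s z) ∧ ∀ x ∈ W₃, ¬ (openGraph ω).Reachable t x}) -
      (prodBernoulli w).real {ω : BondConfig V | ¬ (openGraph ω).Reachable s t} *
        ((prodBernoulli w).real ({ω : BondConfig V | ¬ (openGraph ω).Reachable s t} ∩
          {ω : BondConfig V | (∀ z ∈ Z₁, (openGraph ω).Reachable s z) ∧ ∀ x ∈ W₁, ¬ (openGraph ω).Reachable t x}) *
          (prodBernoulli w).real ({ω : BondConfig V | ¬ (openGraph ω).Reachable s t} ∩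
          ({ω : BondConfig V | (∀ z ∈ Z₂, (openGraph ω).Reachable s z) ∧ ∀ x ∈ W₂, ¬ (openGraph ω).Reachable t x} ∩
          {ω : BondConfig V | (∀ z ∈ Z₃, (openGraph ω).Reachable s z) ∧ ∀ x ∈ W₃, ¬ (openGraph ω).Reachable t x})) +
        (prodBernoulli w).real ({ω : BondConfig V | ¬ (openGraph ω).Reachable s t} ∩
          {ω : BondConfig V | (∀ z ∈ Z₂, (openGraph ω).Reachable s z) ∧ ∀ x ∈ W₂, ¬ (openGraph ω).Reachable t x}) *
          (prodBernoulli w).real ({ω : BondConfig V | ¬ (openGraph ω).Reachable s t} ∩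
          ({ω : BondConfig V | (∀ z ∈ Z₁, (openGraph ω).Reachable s z) ∧ ∀ x ∈ W₁, ¬ (openGraph ω).Reachable t x} ∩
          {ω : BondConfig V | (∀ z ∈ Z₃, (openGraph ω).Reachable s z) ∧ ∀ x ∈ W₃, ¬ (openGraph ω).Reachable t x})) +
        (prodBernoulli w).real ({ω : BondConfig V | ¬ (openGraph ω).Reachable s t} ∩
          {ω : BondConfig V | (∀ z ∈ Z₃, (openGraph ω).Reachable s z) ∧ ∀ x ∈ W₃, ¬ (openGraph ω).Reachable t x}) *
          (prodBernoulli w).real ({ω : BondConfig V | ¬ (openGraph ω).Reachable s t} ∩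
          ({ω : BondConfig V | (∀ z ∈ Z₁, (openGraph ω).Reachable s z) ∧ ∀ x ∈ W₁, ¬ (openGraph ω).Reachable t x} ∩
          {ω : BondConfig V | (∀ z ∈ Z₂, (openGraph ω).Reachable s z) ∧ ∀ x ∈ W₂, ¬ (openGraph ω).Reachable t x}))) := by
  classical
  set μ := prodBernoulli w with hμ
  set D : Set (BondConfig V) := {ω | ¬ (openGraph ω).Reachable s t} with hD
  set F₁ : Set (BondConfig V) :=
    {ω | (∀ z ∈ Z₁, (openGraph ω).Reachable s z) ∧ ∀ x ∈ W₁, ¬ (openGraph ω).Reachable t x} with hF₁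
  set F₂ : Set (BondConfig V) :=
    {ω | (∀ z ∈ Z₂, (openGraph ω).Reachable s z) ∧ ∀ x ∈ W₂, ¬ (openGraph ω).Reachable t x} with hF₂
  set F₃ : Set (BondConfig V) :=
    {ω | (∀ z ∈ Z₃, (openGraph ω).Reachable s z) ∧ ∀ x ∈ W₃, ¬ (openGraph ω).Reachable t x} with hF₃
  have hc₁ := cell_closed s t Z₁ W₁
  have hc₃ := cell_closed s t Z₃ W₃
  have hG₁ : {ω : BondConfig V | ∀ s' ∈ ({s} : Set V), ∀ t' ∈ ({t} : Set V), ¬ (openGraph ω).Reachable s' t'} = D := by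
    ext ω; simp [hD]
  -- nestedness: `F₁ ⊆ F₂`
  have hsub : F₁ ⊆ F₂ := fun ω hω => ⟨fun z hz => hω.1 z (hZ hz), fun x hx => hω.2 x (hW hx)⟩
  have e12 : F₁ ∩ F₂ = F₁ := Set.inter_eq_left.2 hsub
  rw [e12]
  -- BHK Thm 1.5 given `D` for `(F₁, F₃)`: `x₁ * x₃ ≤ x₁₃ * d`
  have h1 := guard_posCorr w ({s} : Set V) (Set.mem_singleton s) (t := t) hc₁ hc₃
  rw [hG₁] at h1
  set d := μ.real D with hd
  set x1 := μ.real (D ∩ F₁) with hx1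
  set x2 := μ.real (D ∩ F₂) with hx2
  set x3 := μ.real (D ∩ F₃) with hx3
  set x13 := μ.real (D ∩ (F₁ ∩ F₃)) with hx13
  set x23 := μ.real (D ∩ (F₂ ∩ F₃)) with hx23
  have hx2d : x2 ≤ d := measureReal_mono Set.inter_subset_left
  have hx23 : x23 ≤ x3 := measureReal_mono (by intro ω hω; exact ⟨hω.1, hω.2.2⟩)
  have hd0 : 0 ≤ d := measureReal_nonneg
  have hx10 : 0 ≤ x1 := measureReal_nonneg
  have key : 2 * x13 * d ^ 2 + x1 * x2 * x3 - d * (x1 * x23 + x2 * x13 + x3 * x1) =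
      (x13 * d - x1 * x3) * (2 * d - x2) + d * x1 * (x3 - x23) := by ring
  rw [key]
  exact add_nonneg (mul_nonneg (sub_nonneg.2 h1) (by linarith))
    (mul_nonneg (mul_nonneg hd0 hx10) (sub_nonneg.2 hx23))
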